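import Summits.Ventures.PercRepro.Night2SevenFiveFinal
import Summits.Ventures.PercRepro.RankLevelSetPlaneTen

/-!
# PercRepro — C-025 AT `(7, 5)` ON EVERY FINITE MATROID, UNCONDITIONALLY (night-2, gen 4)

`rls_seven_five_of_ten_only` (`Night2SevenFiveFinal`) reduces the `(7, 5)` row to the rank-`4` flat bound
`f(4) ≤ 10` on the core; night-1's `core_flat_four_le_ten` (`RankLevelSetPlaneTen`, mine-4's proof from kernel facts)
is that bound in exactly the binder form the composition takes.  Hence **`rls_seven_five_unconditional : ∀ M finite,
RLS M 7 5`** and its set-builder spelling `c025_seven_five_unconditional` — the first open row of C-025 on every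
finite matroid, assembled from: night-4's coloop bridge and type-`2` theorem, THEOREM R5″ (the type-`3` certificates of
gen 3), the type-`4` and trace-sum certificates of gen 4, the cover lemmas of night-3, the plane / flat bounds of
night-1.  Imports `Night2SevenFiveFinal` and `RankLevelSetPlaneTen`.
-/
namespace PercRepro.Star

open Finset ThmH SixFour GenQ PerFlat ThmN NightThree

/-- **C-025 at `(7, 5)` on every finite matroid.** -/
theorem rls_seven_five_unconditional {γ : Type} [DecidableEq γ] (M : Matroid γ) [M.Finite] : RLS M 7 5 :=
  rls_seven_five_of_ten_only core_flat_four_le_ten M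

/-- **C-025 at `(7, 5)` in the set-builder spelling of `C025`, on every finite matroid.** -/
theorem c025_seven_five_unconditional {γ : Type} [DecidableEq γ] (M : Matroid γ) [M.Finite] :
    phiK 7 5 * ({A : Set γ | A ⊆ M.E ∧ M.eRk A = ((7 : ℕ) : ℕ∞) ∧ M.eRk (M.E \ A) = ((5 : ℕ) : ℕ∞)}.ncard : ℚ) ≤
      ({A : Set γ | A ⊆ M.E ∧ ((5 : ℕ) : ℕ∞) < M.eRk A ∧ M.eRk A < ((7 : ℕ) : ℕ∞)}.ncard : ℚ) :=
  c025_seven_five_of_ten_only core_flat_four_le_ten M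

end PercRepro.Star
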